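import Summits.MatrixMultiplication.OmegaCensus.SmallFormats.GF2FlatteningCheck
import HarnessLib

/-!
# ω-census family (a), GF(2) rank floors: per-orbit side checks (non-vanishing, covering, sandwich lookups)

Cell `pub-omega` (unit `pub-omega-lit`, gen 4), topic `Summits/MatrixMultiplication/OmegaCensus` (sub-folder
`SmallFormats`). Framing (verbatim): lottery ticket; floor = certified bounds/negative ranges. HONEST FRAMING:
replay infrastructure (design note `pub-omega-lit/KERNEL-GF2-FLOORS-DESIGN.md` §7, layers R4/R5); nothing here
is progress on `ω`. PROVED, no facts. The Boolean checks discharge, for `S_K ⊆ 𝔽₂^{l×m}` and the constrained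
map `ψ_K`, the side hypotheses of `le_card_of_check_root` (Wang 2026 §6–§7, file
`Literature/…/SubstitutionBacktracking.lean`) and the lookups of the orbit table (Wang 2026, Lemma 1, file
`Literature/…/ConstrainedMatMulSandwich.lean`):

* `nzB` ⇒ `ψ_K ≠ 0`; `coverB` ⇒ the candidate forms cover every form not vanishing on `S_K` (over `𝔽₂` the
  unit is `1`); `sandB` ⇒ a bound for `S_{K'}` transfers to `S_K` along an explicit sandwich `X ↦ P X Q`
  (all `x ∈ S_{K'}` enumerated as bit patterns); `extraOf` / `subOf_append_le` relate the DFS subspaces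
  `constrSubF` to constraint lists.
-/

namespace Summit.MatrixMultiplication.OmegaCensus.GF2RankLB

open Module Matrix Literature.Computability.AlgebraicComplexity

/-! ## Bounded Boolean quantifier -/

/-- `allLT N p`: `p x` for all `x < N`. -/
def allLT (p : ℕ → Bool) : ℕ → Bool
  | 0 => true
  | N + 1 => allLT p N && p N

/-- Specification of `allLT`. -/
theorem allLT_iff (p : ℕ → Bool) : ∀ N, allLT p N = true ↔ ∀ x < N, p x = true
  | 0 => by simp [allLT]
  | N + 1 => by
    rw [allLT, Bool.and_eq_true, allLT_iff p N]
    constructor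
    · rintro ⟨h1, h2⟩ x hx
      rcases Nat.lt_succ_iff_lt_or_eq.1 hx with h | rfl
      · exact h1 x h
      · exact h2
    · intro h
      exact ⟨fun x hx => h x (Nat.lt_succ_of_lt hx), h N (Nat.lt_succ_self N)⟩

/-! ## Non-vanishing -/

/-- Check that `ψ_K ≠ 0`: an element `x ∈ S_K` and coordinates `b, c` with a nonzero tensor entry. -/
def nzB (l m n : ℕ) (K : List ℕ) (x b c : ℕ) : Bool :=
  memB (l * m) K x && decide (b < m * n) && decide (c < l * n) && tbit m n x b c

/-- Soundness of `nzB`. -/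
theorem psiK_ne_zero {l m n : ℕ} {K : List ℕ} {x b c : ℕ} (h : nzB l m n K x b c = true) :
    psiK l m n K ≠ 0 := by
  simp only [nzB, Bool.and_eq_true, decide_eq_true_eq] at h
  obtain ⟨⟨⟨hx, hb⟩, hc⟩, ht⟩ := h
  intro h0
  have := congrArg (fun ψ => eC l n ⟨c, hc⟩ (ψ (elemOf l m K x hx) (vB m n ⟨b, hb⟩))) h0
  simp only [LinearMap.zero_apply, map_zero, LinearMap.comp_apply, Submodule.subtype_apply, elemOf,
    mulBilin_apply, eC_mul_vB, ht, if_true] at this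
  exact one_ne_zero this

/-! ## Covering by candidate forms -/

/-- Position of the highest set bit below `N` (structural search; `0` if none). -/
def topBit (κ : ℕ) : ℕ → ℕ
  | 0 => 0
  | p + 1 => if κ.testBit p then p else topBit κ p

/-- Reduce a form modulo the constraint forms `K` (xor away `κ` whenever the bit at `κ`'s leading position,
searched below bit `16`, is set). Any such sequence of xors preserves the restriction of the form to `S_K`;
no canonicity is claimed (for a reduced-echelon `K` one pass is the full reduction). -/
def reduceB : List ℕ → ℕ → ℕ
  | [], g => g
  | κ :: K, g => reduceB K (if g.testBit (topBit κ 16) then g ^^^ κ else g)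

/-- `reduceB K g` and `g` define the same form on `S_K`. -/
theorem form_reduceB_eq {l m : ℕ} : ∀ (K : List ℕ) (g : ℕ),
    ∀ u ∈ subOf l m K, form l m (reduceB K g) u = form l m g u
  | [], g, u, _ => rfl
  | κ :: K, g, u, hu => by
    have hu' : u ∈ subOf l m K := by
      rw [subOf, mem_constrSub] at hu ⊢
      exact fun κ' hκ' => hu κ' (by simp only [List.map_cons, List.mem_cons]; exact Or.inr hκ')
    have hκ : form l m κ u = 0 := by
      rw [subOf, mem_constrSub] at hu
      exact hu _ (by simp)
    simp only [reduceB]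
    rw [form_reduceB_eq K _ u hu']
    split
    · rw [form_xor, LinearMap.add_apply, hκ, add_zero]
    · rfl

/-- Covering check: every form reduces modulo `K` to `0` or to a listed candidate. -/
def coverB (l m : ℕ) (K cands : List ℕ) : Bool :=
  allLT (fun g => reduceB K g == 0 || cands.contains (reduceB K g)) (2 ^ (l * m))

/-- The candidate forms as a `Fin`-indexed family. -/
def candF (l m : ℕ) (cands : List ℕ) : Fin cands.length → Module.Dual (ZMod 2) (Matrix (Fin l) (Fin m) (ZMod 2)) :=
  fun i => form l m (cands.getD i 0)

/-- `form l m 0 = 0`. -/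
theorem form_zero (l m : ℕ) : form l m 0 = 0 := by
  apply LinearMap.ext; intro X; simp [form_apply]

/-- Soundness of `coverB`: the covering hypothesis of `le_card_of_check_root`. -/
theorem cover_of_coverB {l m : ℕ} {K cands : List ℕ} (h : coverB l m K cands = true) :
    ∀ f : Module.Dual (ZMod 2) (constrSub (K.map (form l m))), f ≠ 0 →
      ∃ i, ∃ a : ZMod 2, a ≠ 0 ∧ ∀ u, f u = a * candF l m cands i u := by
  apply cover_of_forall_dual
  rw [forall_dual_iff]
  intro κ hκ ⟨u, hu, hne⟩
  rw [coverB, allLT_iff] at h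
  have hr := h κ hκ
  simp only [Bool.or_eq_true, beq_iff_eq] at hr
  rcases hr with hr | hr
  · exfalso
    apply hne
    rw [← form_reduceB_eq K κ u hu, hr, form_zero, LinearMap.zero_apply]
  · rw [List.contains_iff_mem] at hr
    obtain ⟨i, hi⟩ := List.get_of_mem hr
    refine ⟨i, 1, one_ne_zero, fun v hv => ?_⟩
    rw [one_mul, candF, List.getD_eq_getElem _ _ i.2, ← List.get_eq_getElem, hi]
    exact (form_reduceB_eq K κ v hv).symm

/-! ## Sandwich lookups -/

/-- Sandwich check: `P' P = 1`, `Q Q' = 1`, and `P x Q ∈ S_{Kt}` for every `x ∈ S_{Kr}` (all `x` enumerated). -/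
def sandB (l m : ℕ) (Kr Kt : List ℕ) (P Pi Q Qi : ℕ) : Bool :=
  (mulBits l l l Pi P == oneBits l) && (mulBits m m m Q Qi == oneBits m) &&
    allLT (fun x => !memB (l * m) Kr x || memB (l * m) Kt (mulBits l m m (mulBits l l m P x) Q)) (2 ^ (l * m))

/-- Soundness of `sandB` (Wang 2026, Lemma 1 with explicit witness): a lower bound for all computations on
`S_{Kr}` is a lower bound for all computations on `S_{Kt}`. -/
theorem le_of_sandB {l m n : ℕ} {Kr Kt : List ℕ} {P Pi Q Qi : ℕ} (h : sandB l m Kr Kt P Pi Q Qi = true)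
    {b : ℕ} (hb : ∀ r, BilinComp (psiK l m n Kr) (Fin r) → b ≤ r) (r : ℕ)
    (β : BilinComp (psiK l m n Kt) (Fin r)) : b ≤ r := by
  simp only [sandB, Bool.and_eq_true, beq_iff_eq] at h
  obtain ⟨⟨hP, hQ⟩, hmap⟩ := h
  rw [allLT_iff] at hmap
  refine hb r (β.ofSandwichLE (ofBits l l P) (ofBits l l Pi) (ofBits m m Q) (ofBits m m Qi)
    (ofBits_eq_one_of_mulBits_eq hP) (ofBits_eq_one_of_mulBits_eq hQ) ?_)
  rw [forall_matrix_iff]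
  intro x hx hmem
  have h1 := hmap x hx
  rw [ofBits_mem_subOf_iff] at hmem
  simp only [hmem, Bool.not_true, Bool.false_or] at h1
  rw [← ofBits_mulBits, ← ofBits_mulBits, ofBits_mem_subOf_iff]
  exact h1

/-! ## DFS subspaces as constraint lists -/

/-- The extra constraint forms named by an `F`-mask: `cands[i]` for the set bits `i < |cands|`. -/
def extraOf (cands : List ℕ) (fm : ℕ) : List ℕ :=
  ((List.range cands.length).filter fun i => fm.testBit i).map fun i => cands.getD i 0

/-- The mask of a set of candidate indices. -/
def maskOfF {N : ℕ} (F : Finset (Fin N)) : ℕ :=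
  maskOf (fun i => if h : i < N then decide ((⟨i, h⟩ : Fin N) ∈ F) else false) N

/-- Bits of `maskOfF`. -/
theorem testBit_maskOfF {N : ℕ} (F : Finset (Fin N)) (i : Fin N) :
    (maskOfF F).testBit i = decide (i ∈ F) := by
  simp [maskOfF, testBit_maskOf, i.2]

/-- The constraint-list subspace `S_{K ++ extraOf cands (maskOfF F)}` is contained in the DFS subspace
`S_F = S_K ∩ ⋂_{i ∈ F} ker cands[i]`. -/
theorem subOf_append_le {l m : ℕ} (K cands : List ℕ) (F : Finset (Fin cands.length)) :
    subOf l m (K ++ extraOf cands (maskOfF F)) ≤ constrSubF (K.map (form l m)) (candF l m cands) F := by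
  intro u hu
  rw [mem_constrSubF]
  have hu' : ∀ κ ∈ K ++ extraOf cands (maskOfF F), form l m κ u = 0 := fun κ hκ =>
    (mem_constrSub.1 hu) _ (List.mem_map.2 ⟨κ, hκ, rfl⟩)
  refine ⟨mem_constrSub.2 fun κ' hκ' => ?_, fun i hi => ?_⟩
  · obtain ⟨κ, hκ, rfl⟩ := List.mem_map.1 hκ'
    exact hu' κ (List.mem_append_left _ hκ)
  · apply hu'
    apply List.mem_append_right
    simp only [extraOf, List.mem_map, List.mem_filter, List.mem_range]
    exact ⟨i, ⟨i.2, by rw [testBit_maskOfF]; simpa using hi⟩, rfl⟩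

end Summit.MatrixMultiplication.OmegaCensus.GF2RankLB
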